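import Summits.BirchSwinnertonDyer.BirchSwinnertonDyer.Theorems.PrintCf2SplitBadTwoTwoVarSpecializationFiniteJunk
import Mathlib.LinearAlgebra.Matrix.Charpoly.LinearMap
import HarnessLib

/-!
# Route C `PrintCf2RubinValueTwo`, crux `RestrictedMainConjWithValueAtTwo` (stmt-BirchSwinnertonDyer-23722), stub `stub_restrictedEven` /
# S3b′-v12 — the (SP)∘(RES) SEAM, pure algebra: `T₁`-REGULARITY of a two-variable dual FOLLOWS from `Λ`-torsion of the datum on the line,
# and `Module.Finite` / `Module.IsTorsion` / the characteristic ideal TRANSFER along the exact (RES) map `QuotSMulTop T₁ X ↪ Y` (finite cokernel)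

Cell `bsd-print-cf2`, width seat `bsd-line-cf2c-w8` g2 (prover-bsd-line-cf2c-w8-g2-0); `--supports stmt-BirchSwinnertonDyer-23722`.
HONEST FRAMING: nothing here closes the crux or the registered stub; BSD is not proved by any of this; no summit statement is proved by this
seat. No definition, no named fact, no `sorry`. Generic: any prime `p`, `Λ₂ = IwasawaAlgebra₂ p = Λ⟦T₁⟧` over `Λ = IwasawaAlgebra p = ℤ_p⟦T₂⟧`,
the `Λ`-structure on `X ⧸ T₁X = QuotSMulTop PowerSeries.X X` being the restriction along the CONSTANTS `PowerSeries.C : Λ → Λ₂` (pinned by `letI …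
Module.compHom _ PowerSeries.C`, the spelling of cf2c-w8 g0's (RES) files and of -w4 g10 / -w5 g4's specialisation files).

WHY (LEAD g13 skeleton v12, `stub_restrictedMainConj_two_v12`; TURNKEY-S3B-PUSH §3). The Herbrand specialisation
`PowerSeriesSpecialization.charIdeal_quotSMulTop_eq_mul` and its S3n′ form -w5 g4 `TwoVarSpecializationFinite.map_constantCoeff_charIdeal_eq_of_pseudoNull_finite`
carry the hypothesis `hs : ∃ s : Λ₂, s(0) ≠ 0 ∧ s • X = 0` («`(T₁) ∉ Supp X`», `T₁`-regularity). In the v12 push the two-variable dual `X = D₂.X` is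
compared with the Greenberg–Vatsal datum `Y = D_nr.X` on the line by cf2c-w8 g0's EXACT control map `f : QuotSMulTop T₁ X →ₗ[Λ] Y`, injective with
finite cokernel (`LinePush.exists_linearMap_quotSMulTop_unr`, p685748). This file shows that `hs` is then EQUIVALENT to `Λ`-torsion of `Y`, and moves
finite generation, torsion and the characteristic ideal across `f`:

* §1 **`exists_constantCoeff_ne_zero_of_isTorsion_quotSMulTop`** — `X` finitely generated over `Λ₂` with `X ⧸ T₁X` `Λ`-torsion ⟹ some `s` with
  `s(0) ≠ 0` kills `X`: one `c ∈ Λ ∖ 0` kills the finitely generated torsion quotient, so `C c • X ≤ T₁ • X`, and Cayley–Hamilton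
  (`LinearMap.exists_monic_and_natDegree_eq_and_coeff_mem_pow_and_aeval_eq_zero`) gives a monic `q` with lower coefficients in `(T₁)` and
  `q(C c) • X = 0`; `s := q(C c)` has `s(0) = cⁿ ≠ 0`. Converse `isTorsion_quotSMulTop_of_exists` (`s(0)` kills `X ⧸ T₁X`).
* §2 transfer along a `Λ`-linear `f : Q →ₗ Y` with `Finite (Y ⧸ range f)`: `moduleFinite_of_finite_quotient_range`, `isTorsion_of_finite_quotient_range`,
  and `isTorsion_of_injective` (torsion pulls back along injections).
* §3 the (RES) shape `f : QuotSMulTop T₁ X →ₗ[Λ] Y` injective with finite cokernel: **`moduleFinite_of_linePush`** (`Y` finitely generated),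
  **`exists_constantCoeff_ne_zero_of_linePush`** (`Y` torsion ⟹ `T₁`-regularity of `X`), **`isTorsion_iff_of_linePush`**, and
  **`charIdeal_eq_map_constantCoeff_of_linePush`**: `Y` torsion ∧ S3n′ for `X` (every pseudo-null `Λ₂`-submodule finite) ⟹
  `charIdeal Λ Y = (charIdeal Λ₂ X).map constantCoeff` — (SP)∘(RES) with the ONE hypothesis on the line side displayed (`Module.IsTorsion Λ Y`; on
  road α it is supplied by (FIN) + control, see the frame sequel).
presearch: Bourbaki AC VII §4.4–4.5, Matsumura Thm. 2.1 (Cayley–Hamilton), Skinner–Urban 2014 §3.1.6 / Cor. 3.2.9 (ii), Greenberg 2016 Prop. 4.1.1 —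
tree/Mathlib algebra; no new fact. beyond-print theorem: no.

References: [SkinnerUrban2014] §3.1.6, Cor. 3.2.9 (ii); [GreenbergLNM1716] §4; [Washington1997] §13.2; Bourbaki AC VII §4.4–4.5; Matsumura, CRT Thm. 2.1.
-/

noncomputable section

open Function
open scoped Pointwise

-- D-0017: single-problem summit, the namespace repeats the problem name by design.
set_option linter.dupNamespace false
set_option autoImplicit false

namespace Summit.BirchSwinnertonDyer.BirchSwinnertonDyer.Theorems.PrintCf2.LineTorsionRegularity

open Literature.NumberTheory.EllipticCurves Literature.NumberTheory.EllipticCurves.Module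
open Summit.BirchSwinnertonDyer.BirchSwinnertonDyer.Theorems.PrintCf2.TwoVarSpecializationFinite

variable (p : ℕ) [Fact p.Prime]

/-! ## §1. `T₁`-regularity from torsion of the specialisation -/

section Regularity

variable (X : Type*) [AddCommGroup X] [Module (IwasawaAlgebra₂ p) X]

/-- `(T₁) = ker constantCoeff`: membership in `Ideal.span {T₁}` is vanishing of the constant term. [folklore] -/
theorem mem_span_X_iff (s : IwasawaAlgebra₂ p) :
    s ∈ Ideal.span {(PowerSeries.X : IwasawaAlgebra₂ p)} ↔ PowerSeries.constantCoeff s = 0 := by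
  rw [Ideal.mem_span_singleton]
  exact PowerSeries.X_dvd_iff

/-- **Converse (easy) direction: a killing element with non-zero constant term makes `X ⧸ T₁X` torsion over `Λ`.** If `s • X = 0` with
`s(0) ≠ 0` then `s(0)` (acting through `PowerSeries.C`) kills `X ⧸ T₁X`, since `s − C(s(0)) ∈ T₁Λ₂`. [cite: SkinnerUrban2014, §3.1.6] -/
theorem isTorsion_quotSMulTop_of_exists
    (hs : ∃ s : IwasawaAlgebra₂ p, PowerSeries.constantCoeff s ≠ 0 ∧ ∀ m : X, s • m = 0) :
    letI : Module (IwasawaAlgebra p) (QuotSMulTop (PowerSeries.X : IwasawaAlgebra₂ p) X) :=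
      Module.compHom _ (PowerSeries.C (R := IwasawaAlgebra p))
    Module.IsTorsion (IwasawaAlgebra p) (QuotSMulTop (PowerSeries.X : IwasawaAlgebra₂ p) X) := by
  letI : Module (IwasawaAlgebra p) (QuotSMulTop (PowerSeries.X : IwasawaAlgebra₂ p) X) :=
    Module.compHom _ (PowerSeries.C (R := IwasawaAlgebra p))
  obtain ⟨s, hs0, hs⟩ := hs
  intro q
  obtain ⟨m, rfl⟩ := Submodule.Quotient.mk_surjective _ q
  refine ⟨⟨PowerSeries.constantCoeff s, mem_nonZeroDivisors_of_ne_zero hs0⟩, ?_⟩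
  -- `C(s(0)) • m = s • m - (s - C(s(0))) • m ∈ T₁ • X`
  obtain ⟨r, hr⟩ : (PowerSeries.X : IwasawaAlgebra₂ p) ∣ s - PowerSeries.C (PowerSeries.constantCoeff s) :=
    PowerSeries.X_dvd_iff.mpr (by rw [map_sub, PowerSeries.constantCoeff_C, sub_self])
  change (PowerSeries.C (PowerSeries.constantCoeff s) : IwasawaAlgebra₂ p) •
      (Submodule.Quotient.mk m : QuotSMulTop (PowerSeries.X : IwasawaAlgebra₂ p) X) = 0
  rw [← Submodule.Quotient.mk_smul, Submodule.Quotient.mk_eq_zero]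
  have hCm : (PowerSeries.C (PowerSeries.constantCoeff s) : IwasawaAlgebra₂ p) • m =
      -((PowerSeries.X : IwasawaAlgebra₂ p) • (r • m)) := by
    have h1 : (PowerSeries.C (PowerSeries.constantCoeff s) : IwasawaAlgebra₂ p) = s - PowerSeries.X * r := by
      rw [← hr, sub_sub_cancel]
    rw [h1, sub_smul, hs, zero_sub, mul_smul]
  rw [hCm]
  exact Submodule.neg_mem _ (Submodule.smul_mem_pointwise_smul _ _ ⊤ Submodule.mem_top)

variable [Module.Finite (IwasawaAlgebra₂ p) X]

/-- One non-zero constant kills `X ⧸ T₁X` when it is `Λ`-torsion: `C c • X ≤ T₁ • X` for some `c ≠ 0` (product of the annihilators of finitely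
many `Λ₂`-generators; `Λ` is a domain). [folklore] -/
theorem exists_C_smul_mem_of_isTorsion_quotSMulTop
    (htor : letI : Module (IwasawaAlgebra p) (QuotSMulTop (PowerSeries.X : IwasawaAlgebra₂ p) X) :=
        Module.compHom _ (PowerSeries.C (R := IwasawaAlgebra p))
      Module.IsTorsion (IwasawaAlgebra p) (QuotSMulTop (PowerSeries.X : IwasawaAlgebra₂ p) X)) :
    ∃ c : IwasawaAlgebra p, c ≠ 0 ∧ ∀ m : X,
      (PowerSeries.C c : IwasawaAlgebra₂ p) • m ∈ (PowerSeries.X : IwasawaAlgebra₂ p) • (⊤ : Submodule (IwasawaAlgebra₂ p) X) := by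
  letI instQ : Module (IwasawaAlgebra p) (QuotSMulTop (PowerSeries.X : IwasawaAlgebra₂ p) X) :=
    Module.compHom _ (PowerSeries.C (R := IwasawaAlgebra p))
  classical
  -- each element is killed into `T₁ • X` by some non-zero constant
  have hc : ∀ x : X, ∃ c : IwasawaAlgebra p, c ≠ 0 ∧
      (PowerSeries.C c : IwasawaAlgebra₂ p) • x ∈ (PowerSeries.X : IwasawaAlgebra₂ p) • (⊤ : Submodule (IwasawaAlgebra₂ p) X) := by
    intro x
    obtain ⟨⟨a, ha⟩, hax⟩ := @htor (Submodule.Quotient.mk x)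
    refine ⟨a, nonZeroDivisors.ne_zero ha, ?_⟩
    rw [← Submodule.Quotient.mk_eq_zero, Submodule.Quotient.mk_smul]
    exact hax
  choose c hc0 hcmem using hc
  obtain ⟨S, hS⟩ := (‹Module.Finite (IwasawaAlgebra₂ p) X›).fg_top
  refine ⟨∏ x ∈ S, c x, Finset.prod_ne_zero_iff.mpr fun x _ ↦ hc0 x, fun m ↦ ?_⟩
  have hm : m ∈ Submodule.span (IwasawaAlgebra₂ p) (S : Set X) := by rw [hS]; exact Submodule.mem_top
  induction hm using Submodule.span_induction with
  | mem x hx =>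
      rw [← Finset.prod_erase_mul _ _ hx, map_mul, mul_smul]
      exact Submodule.smul_mem _ _ (hcmem x)
  | zero => rw [smul_zero]; exact Submodule.zero_mem _
  | add x y _ _ hx hy => rw [smul_add]; exact Submodule.add_mem _ hx hy
  | smul r x _ hx => rw [smul_comm]; exact Submodule.smul_mem _ _ hx

/-- **`T₁`-REGULARITY FROM TORSION OF THE SPECIALISATION.** For a finitely generated `Λ₂ = Λ⟦T₁⟧`-module `X` whose quotient `X ⧸ T₁X` is
`Λ`-torsion (`Λ` through the constants `PowerSeries.C`), some `s ∈ Λ₂` with NON-ZERO CONSTANT TERM kills `X` — the hypothesis `hs` of the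
Herbrand specialisation (`PowerSeriesSpecialization.charIdeal_quotSMulTop_eq_mul`, -w4 g10 / -w5 g4's `map_constantCoeff_charIdeal_eq_…`). Proof:
`C c • X ≤ T₁ • X` for one `c ≠ 0` (`exists_C_smul_mem_of_isTorsion_quotSMulTop`); Cayley–Hamilton for the endomorphism `C c` with image in
`(T₁) • X` gives a monic `q ∈ Λ₂[Y]` with `coeff_k q ∈ (T₁)^{n−k}` and `q(C c) • X = 0`; `s := q(C c)` has `s − (C c)ⁿ ∈ (T₁)`, so `s(0) = cⁿ ≠ 0`.
[cite: SkinnerUrban2014, §3.1.6] [cite: Washington1997, §13.2] -/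
theorem exists_constantCoeff_ne_zero_of_isTorsion_quotSMulTop
    (htor : letI : Module (IwasawaAlgebra p) (QuotSMulTop (PowerSeries.X : IwasawaAlgebra₂ p) X) :=
        Module.compHom _ (PowerSeries.C (R := IwasawaAlgebra p))
      Module.IsTorsion (IwasawaAlgebra p) (QuotSMulTop (PowerSeries.X : IwasawaAlgebra₂ p) X)) :
    ∃ s : IwasawaAlgebra₂ p, PowerSeries.constantCoeff s ≠ 0 ∧ ∀ m : X, s • m = 0 := by
  obtain ⟨c, hc0, hc⟩ := exists_C_smul_mem_of_isTorsion_quotSMulTop p X htor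
  set Λ₂ := IwasawaAlgebra₂ p
  set t : Λ₂ := PowerSeries.C c with ht
  set I : Ideal Λ₂ := Ideal.span {(PowerSeries.X : Λ₂)} with hI
  let φ : Module.End Λ₂ X := Algebra.lsmul Λ₂ Λ₂ X t
  have hφ : LinearMap.range φ ≤ I • (⊤ : Submodule Λ₂ X) := by
    rintro _ ⟨m, rfl⟩
    change t • m ∈ _
    rw [hI, Submodule.ideal_span_singleton_smul]
    exact hc m
  obtain ⟨q, hmonic, -, hcoeff, hq⟩ :=
    LinearMap.exists_monic_and_natDegree_eq_and_coeff_mem_pow_and_aeval_eq_zero Λ₂ φ I hφ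
  -- `s := q(t)` kills `X`
  set s : Λ₂ := Polynomial.aeval t q with hs
  have hsX : ∀ m : X, s • m = 0 := by
    intro m
    have h1 : Polynomial.aeval φ q = Algebra.lsmul Λ₂ Λ₂ X s := by
      rw [hs, show φ = Algebra.lsmul Λ₂ Λ₂ X t from rfl, Polynomial.aeval_algHom_apply]
    have h2 := LinearMap.congr_fun hq m
    rw [h1] at h2
    simpa using h2
  -- `s - tⁿ ∈ (T₁)`
  have hst : s - t ^ q.natDegree ∈ I := by
    rw [hs, Polynomial.aeval_eq_sum_range, Finset.sum_range_succ, hmonic.coeff_natDegree, one_smul,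
      add_sub_cancel_right]
    refine Submodule.sum_mem _ fun i hi ↦ ?_
    rw [Finset.mem_range] at hi
    have hci : q.coeff i ∈ I := Ideal.pow_le_self (by omega) (hcoeff i)
    rw [smul_eq_mul]
    exact Ideal.mul_mem_right _ _ hci
  refine ⟨s, ?_, hsX⟩
  -- constant term: `s(0) = cⁿ ≠ 0`
  have h0 : PowerSeries.constantCoeff (s - t ^ q.natDegree) = 0 := (mem_span_X_iff p _).mp (hI ▸ hst)
  rw [map_sub, sub_eq_zero, map_pow, ht, PowerSeries.constantCoeff_C] at h0
  rw [h0]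
  exact pow_ne_zero _ hc0

/-- **`T₁`-regularity ⟺ torsion of the specialisation** (§1 both ways). [cite: SkinnerUrban2014, §3.1.6] -/
theorem exists_constantCoeff_ne_zero_iff_isTorsion_quotSMulTop :
    (∃ s : IwasawaAlgebra₂ p, PowerSeries.constantCoeff s ≠ 0 ∧ ∀ m : X, s • m = 0) ↔
      (letI : Module (IwasawaAlgebra p) (QuotSMulTop (PowerSeries.X : IwasawaAlgebra₂ p) X) :=
        Module.compHom _ (PowerSeries.C (R := IwasawaAlgebra p));
      Module.IsTorsion (IwasawaAlgebra p) (QuotSMulTop (PowerSeries.X : IwasawaAlgebra₂ p) X)) :=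
  ⟨isTorsion_quotSMulTop_of_exists p X, exists_constantCoeff_ne_zero_of_isTorsion_quotSMulTop p X⟩

end Regularity

/-! ## §2. Transfer along a `Λ`-linear map with finite cokernel -/

section Transfer

variable {Q Y : Type*} [AddCommGroup Q] [Module (IwasawaAlgebra p) Q] [AddCommGroup Y] [Module (IwasawaAlgebra p) Y]

/-- Torsion pulls back along an injective linear map (any commutative ring). [folklore] -/
theorem isTorsion_of_injective {R : Type*} [CommRing R] {M N : Type*} [AddCommGroup M] [Module R M] [AddCommGroup N] [Module R N]
    (f : M →ₗ[R] N) (hf : Function.Injective f) (hN : Module.IsTorsion R N) : Module.IsTorsion R M := by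
  intro x
  obtain ⟨a, ha⟩ := @hN (f x)
  refine ⟨a, hf ?_⟩
  rw [Submonoid.smul_def, map_smul, ← Submonoid.smul_def, ha, map_zero]

/-- **`Y` is finitely generated over `Λ`** when it receives a `Λ`-linear map from a finitely generated module with finite cokernel
(`range f` and `Y ⧸ range f` are finitely generated). [folklore] -/
theorem moduleFinite_of_finite_quotient_range (f : Q →ₗ[IwasawaAlgebra p] Y) [Module.Finite (IwasawaAlgebra p) Q]
    [Finite (Y ⧸ LinearMap.range f)] : Module.Finite (IwasawaAlgebra p) Y := by
  haveI : Module.Finite (IwasawaAlgebra p) (Y ⧸ LinearMap.range f) := Module.Finite.of_finite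
  refine Module.finite_def.mpr (Submodule.fg_of_fg_map_of_fg_inf_ker (LinearMap.range f).mkQ ?_ ?_)
  · rw [Submodule.map_top, Submodule.range_mkQ]
    exact Module.finite_def.mp inferInstance
  · rw [top_inf_eq, Submodule.ker_mkQ, LinearMap.range_eq_map]
    exact (Module.finite_def.mp inferInstance).map f

/-- **`Y` is `Λ`-torsion** when it receives a `Λ`-linear map from a torsion module with finite cokernel: `#(Y ⧸ range f) • y ∈ range f` is killed
by a non-zero-divisor, and `#(Y ⧸ range f) ≠ 0` in `Λ`. [cite: Washington1997, §13.2] -/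
theorem isTorsion_of_finite_quotient_range (hQ : Module.IsTorsion (IwasawaAlgebra p) Q) (f : Q →ₗ[IwasawaAlgebra p] Y)
    [Finite (Y ⧸ LinearMap.range f)] : Module.IsTorsion (IwasawaAlgebra p) Y := by
  intro y
  set n : ℕ := Nat.card (Y ⧸ LinearMap.range f) with hn
  have hn0 : n ≠ 0 := Nat.card_pos.ne'
  have hnΛ : (n : IwasawaAlgebra p) ≠ 0 := by
    intro h0
    have h1 := congrArg (PowerSeries.constantCoeff (R := ℤ_[p])) h0
    rw [map_natCast, map_zero] at h1
    exact hn0 (by exact_mod_cast h1)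
  have hmem : (n : IwasawaAlgebra p) • y ∈ LinearMap.range f := by
    rw [← Submodule.Quotient.mk_eq_zero, Submodule.Quotient.mk_smul, Nat.cast_smul_eq_nsmul]
    exact card_nsmul_eq_zero'
  obtain ⟨x, hx⟩ := hmem
  obtain ⟨⟨a, ha⟩, hax⟩ := @hQ x
  refine ⟨⟨a * (n : IwasawaAlgebra p), mul_mem ha (mem_nonZeroDivisors_of_ne_zero hnΛ)⟩, ?_⟩
  change (a * (n : IwasawaAlgebra p)) • y = 0
  rw [mul_smul, ← hx, ← map_smul, show a • x = 0 from hax, map_zero]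

/-- An injective `Λ`-linear map with finite cokernel is a pseudo-isomorphism; source and target have the same characteristic ideal.
[cite: Washington1997, §13.2] -/
theorem charIdeal_eq_of_injective_of_finite_quotient_range (f : Q →ₗ[IwasawaAlgebra p] Y) (hf : Function.Injective f)
    [Finite (Y ⧸ LinearMap.range f)] : charIdeal (IwasawaAlgebra p) Q = charIdeal (IwasawaAlgebra p) Y := by
  have hker : Module.IsPseudoNull (IwasawaAlgebra p) (LinearMap.ker f) := by
    haveI : Finite (LinearMap.ker f) := by
      rw [LinearMap.ker_eq_bot.mpr hf]
      infer_instance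
    exact isPseudoNull_of_finite p _
  exact charIdeal_eq_of_arePseudoIsomorphic ⟨f, hker, isPseudoNull_of_finite p _⟩

end Transfer

/-! ## §3. The (RES) shape: `f : X ⧸ T₁X ↪ Y` with finite cokernel -/

section LinePush

variable (X : Type*) [AddCommGroup X] [Module (IwasawaAlgebra₂ p) X] [Module.Finite (IwasawaAlgebra₂ p) X]
  {Y : Type*} [AddCommGroup Y] [Module (IwasawaAlgebra p) Y]

/-- `X ⧸ T₁X` is finitely generated over `Λ` (through the constants): the `Λ₂`-generators of `X` generate it, `T₁` acting as `0`
(tree `PowerSeriesSpecialization.moduleFinite_quotSMulTop` in the `Module.compHom` spelling). [folklore] -/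
theorem moduleFinite_quotSMulTop_compHom :
    letI : Module (IwasawaAlgebra p) (QuotSMulTop (PowerSeries.X : IwasawaAlgebra₂ p) X) :=
      Module.compHom _ (PowerSeries.C (R := IwasawaAlgebra p))
    Module.Finite (IwasawaAlgebra p) (QuotSMulTop (PowerSeries.X : IwasawaAlgebra₂ p) X) := by
  -- the constants algebra `C : Λ → Λ₂` (NOT Mathlib's default `T ↦ T₁`)
  let alg : Algebra (IwasawaAlgebra p) (PowerSeries (IwasawaAlgebra p)) :=
    @MvPowerSeries.instAlgebra Unit (IwasawaAlgebra p) (IwasawaAlgebra p) _ _ (Algebra.id _)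
  letI : Module (IwasawaAlgebra p) X := Module.compHom X (PowerSeries.C (R := IwasawaAlgebra p))
  have hIST : @IsScalarTower (IwasawaAlgebra p) (PowerSeries (IwasawaAlgebra p)) X alg.toSMul
      inferInstance inferInstance :=
    @IsScalarTower.mk _ _ _ alg.toSMul _ _ fun a r m => by
      rw [@Algebra.smul_def _ _ _ _ alg a r, mul_smul]
      rfl
  exact @Summit.BirchSwinnertonDyer.BirchSwinnertonDyer.Theorems.SignedBaseChangeAcDivSpecialization.PowerSeriesSpecialization.moduleFinite_quotSMulTop
    (IwasawaAlgebra p) _ X _ _ _ hIST _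

/-- **`Y` is finitely generated over `Λ`** in the (RES) shape: `f : X ⧸ T₁X →ₗ[Λ] Y` with finite cokernel, `X` finitely generated over `Λ₂`.
[cite: GreenbergVatsal2000, §2 pp. 17–21] [cite: Washington1997, §13.2] -/
theorem moduleFinite_of_linePush
    (f : letI : Module (IwasawaAlgebra p) (QuotSMulTop (PowerSeries.X : IwasawaAlgebra₂ p) X) :=
        Module.compHom _ (PowerSeries.C (R := IwasawaAlgebra p))
      QuotSMulTop (PowerSeries.X : IwasawaAlgebra₂ p) X →ₗ[IwasawaAlgebra p] Y)
    (hcoker : letI : Module (IwasawaAlgebra p) (QuotSMulTop (PowerSeries.X : IwasawaAlgebra₂ p) X) :=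
        Module.compHom _ (PowerSeries.C (R := IwasawaAlgebra p))
      Finite (Y ⧸ LinearMap.range f)) :
    Module.Finite (IwasawaAlgebra p) Y := by
  letI : Module (IwasawaAlgebra p) (QuotSMulTop (PowerSeries.X : IwasawaAlgebra₂ p) X) :=
    Module.compHom _ (PowerSeries.C (R := IwasawaAlgebra p))
  haveI := moduleFinite_quotSMulTop_compHom p X
  haveI := hcoker
  exact moduleFinite_of_finite_quotient_range p f

/-- **`T₁`-REGULARITY OF `X` FROM TORSION ON THE LINE**, (RES) shape: if `f : X ⧸ T₁X →ₗ[Λ] Y` is injective and `Y` is `Λ`-torsion, some `s` with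
`s(0) ≠ 0` kills `X`. [cite: SkinnerUrban2014, §3.1.6] [cite: GreenbergVatsal2000, §2 pp. 17–21] -/
theorem exists_constantCoeff_ne_zero_of_linePush
    (f : letI : Module (IwasawaAlgebra p) (QuotSMulTop (PowerSeries.X : IwasawaAlgebra₂ p) X) :=
        Module.compHom _ (PowerSeries.C (R := IwasawaAlgebra p))
      QuotSMulTop (PowerSeries.X : IwasawaAlgebra₂ p) X →ₗ[IwasawaAlgebra p] Y)
    (hf : Function.Injective f) (htor : Module.IsTorsion (IwasawaAlgebra p) Y) :
    ∃ s : IwasawaAlgebra₂ p, PowerSeries.constantCoeff s ≠ 0 ∧ ∀ m : X, s • m = 0 := by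
  letI : Module (IwasawaAlgebra p) (QuotSMulTop (PowerSeries.X : IwasawaAlgebra₂ p) X) :=
    Module.compHom _ (PowerSeries.C (R := IwasawaAlgebra p))
  exact exists_constantCoeff_ne_zero_of_isTorsion_quotSMulTop p X (isTorsion_of_injective f hf htor)

/-- **Torsion on the line ⟺ `T₁`-regularity of `X`**, (RES) shape (`f` injective with finite cokernel).
[cite: SkinnerUrban2014, §3.1.6] [cite: Washington1997, §13.2] -/
theorem isTorsion_iff_of_linePush
    (f : letI : Module (IwasawaAlgebra p) (QuotSMulTop (PowerSeries.X : IwasawaAlgebra₂ p) X) :=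
        Module.compHom _ (PowerSeries.C (R := IwasawaAlgebra p))
      QuotSMulTop (PowerSeries.X : IwasawaAlgebra₂ p) X →ₗ[IwasawaAlgebra p] Y)
    (hf : Function.Injective f)
    (hcoker : letI : Module (IwasawaAlgebra p) (QuotSMulTop (PowerSeries.X : IwasawaAlgebra₂ p) X) :=
        Module.compHom _ (PowerSeries.C (R := IwasawaAlgebra p))
      Finite (Y ⧸ LinearMap.range f)) :
    Module.IsTorsion (IwasawaAlgebra p) Y ↔ ∃ s : IwasawaAlgebra₂ p, PowerSeries.constantCoeff s ≠ 0 ∧ ∀ m : X, s • m = 0 := by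
  letI : Module (IwasawaAlgebra p) (QuotSMulTop (PowerSeries.X : IwasawaAlgebra₂ p) X) :=
    Module.compHom _ (PowerSeries.C (R := IwasawaAlgebra p))
  refine ⟨exists_constantCoeff_ne_zero_of_linePush p X f hf, fun hs ↦ ?_⟩
  haveI := hcoker
  exact isTorsion_of_finite_quotient_range p (isTorsion_quotSMulTop_of_exists p X hs) f

/-- **(SP)∘(RES) — THE CHARACTERISTIC IDEAL OF THE DATUM ON THE LINE IS THE SPECIALISATION `T₁ ↦ 0` OF THE TWO-VARIABLE ONE.** For `X` finitely
generated over `Λ₂ = Λ⟦T₁⟧` all of whose pseudo-null submodules are FINITE (S3n′), and `f : X ⧸ T₁X →ₗ[Λ] Y` injective with finite cokernel (the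
exact (RES) map of cf2c-w8 g0 p685748): if `Y` is `Λ`-torsion then **`charIdeal Λ Y = (charIdeal Λ₂ X).map constantCoeff`**. Chain: `Y` torsion ⟹
`T₁`-regularity of `X` (§1) ⟹ Herbrand with junk factor `1` (-w5 g4 `map_constantCoeff_charIdeal_eq_of_pseudoNull_finite`) ⟹ `ch(X ⧸ T₁X) = ch(Y)`
(pseudo-isomorphism). The single hypothesis on the line side, `Module.IsTorsion Λ Y`, is where the arithmetic enters (on road α: finiteness of the
`Γ`-coinvariants of `Y`, i.e. (FIN) + control). [cite: SkinnerUrban2014, Cor. 3.2.9 (ii)] [cite: Greenberg2016, Prop. 4.1.1]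
[cite: GreenbergVatsal2000, §2 pp. 17–21] -/
theorem charIdeal_eq_map_constantCoeff_of_linePush
    (f : letI : Module (IwasawaAlgebra p) (QuotSMulTop (PowerSeries.X : IwasawaAlgebra₂ p) X) :=
        Module.compHom _ (PowerSeries.C (R := IwasawaAlgebra p))
      QuotSMulTop (PowerSeries.X : IwasawaAlgebra₂ p) X →ₗ[IwasawaAlgebra p] Y)
    (hf : Function.Injective f)
    (hcoker : letI : Module (IwasawaAlgebra p) (QuotSMulTop (PowerSeries.X : IwasawaAlgebra₂ p) X) :=
        Module.compHom _ (PowerSeries.C (R := IwasawaAlgebra p))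
      Finite (Y ⧸ LinearMap.range f))
    (htor : Module.IsTorsion (IwasawaAlgebra p) Y)
    (hfin : ∀ N : Submodule (IwasawaAlgebra₂ p) X, Module.IsPseudoNull (IwasawaAlgebra₂ p) N → Finite N) :
    charIdeal (IwasawaAlgebra p) Y = (charIdeal (IwasawaAlgebra₂ p) X).map (PowerSeries.constantCoeff (R := IwasawaAlgebra p)) := by
  letI : Module (IwasawaAlgebra p) (QuotSMulTop (PowerSeries.X : IwasawaAlgebra₂ p) X) :=
    Module.compHom _ (PowerSeries.C (R := IwasawaAlgebra p))
  have hs := exists_constantCoeff_ne_zero_of_linePush p X f hf htor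
  have hsp := map_constantCoeff_charIdeal_eq_of_pseudoNull_finite p X hs hfin
  haveI := hcoker
  rw [hsp]
  exact (charIdeal_eq_of_injective_of_finite_quotient_range p f hf).symm

end LinePush

end Summit.BirchSwinnertonDyer.BirchSwinnertonDyer.Theorems.PrintCf2.LineTorsionRegularity

end
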